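import Literature.Analysis.FluidPDE.NSBoundedInteriorRegularityProofs
import Literature.Analysis.FluidPDE.NSSuitableESS
import HarnessLib

/-!
# Tools for restarting a weak solution at a regular time: local boundedness, continuous
# representatives at any viscosity, identification of every time slice, local `L²`-continuity

Analysis/FluidPDE proof file (theorems only, no new definitions or facts). It serves the
restarting hypothesis `hLE` of `BarkerPrange2020_thm2_of_localizedSmoothing`
(`BarkerPrangeConcentrationProofs.lean`; Barker–Prange 2020, §4.2, where the Leray–Hopf solution,
regular before its first blow-up time, is restarted at a time `t₀` as a local energy solution):
the clause of Seregin's Def. B.1 that needs the interior regularity theory is (B.1.7), the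
attainment of the datum `u(t₀)` in `L²_loc`, i.e. strong `L²_loc`-continuity of `t ↦ u(t)` at
the regular time `t₀`. The mechanism is the classical one (Caffarelli–Kohn–Nirenberg 1982, §6:
"regular points are those with `u ∈ L^∞` in a neighbourhood", where the solution is continuous
by Serrin's interior regularity; Seregin–Šverák 2009, §2 p. 8; Robinson–Rodrigo–Sadowski 2016,
Thm. 13.5): near a regular point a distributional solution with `L^{3/2}` pressure has a
continuous representative — the tree's theorem `NSBoundedInteriorContinuity_holds` (unit
viscosity, backward cylinders) — and a field that is weakly continuous in time (as Leray–Hopf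
solutions are) coincides with that representative at **every** time, not only almost every time.

* `exists_isOpen_ae_bound_of_forall_isRegularPoint` — a compact set of regular points has a
  neighbourhood on which `u` is essentially bounded (finite subcover by centred cylinders);
* `exists_continuousOn_ae_eq_viscousCylinder` — `NSBoundedInteriorContinuity` at any viscosity
  `ν > 0`: an essentially bounded distributional solution with `L^{3/2}` pressure in a viscous
  cylinder `Q_ν(z, R) = (t - R²/ν, t) × B(x, R)` has a representative continuous on it (the
  viscosity-normalising rescaling `(R/ν) u(t + (R²/ν)s, x + Ry)` maps `Q_ν(z, R)` to the unit
  cylinder; `IsDistributionalNSSolutionOn.stRescale`);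
* `exists_box_continuousOn_ae_eq_of_isRegularPoint` — hence around a regular point lying in an
  open set where `(u, p)` solves the equations with `p ∈ L^{3/2}_loc`, there is an open box
  `(t₀ - δ, t₀ + δ) × B(x, R)` carrying a continuous representative;
* `ae_eq_slice_of_weaklyContinuous_of_continuousOn` — if `t ↦ ∫⟪u(t), w⟫` is continuous for
  every `w ∈ L²` (weak continuity) and `u = v` a.e. on `(a, b) × B` with `v` continuous there,
  then `u(t) = v(t, ·)` a.e. on `B` for **every** `t ∈ (a, b)` (both pairings with `g • e`,
  `g ∈ C_c^∞(B)`, are continuous in `t` and agree a.e., hence everywhere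
  (`Measure.eqOn_open_of_ae_eq`); then the fundamental lemma of the calculus of variations,
  Mathlib's `IsOpen.ae_eq_zero_of_integral_contDiff_smul_eq_zero`);
* `tendsto_lintegral_closedBall_sub_sq_of_continuousOn` — consequently
  `∫_{B̄(x, ρ)} |u(t + s) - u(t)|² → 0` as `s → 0` (uniform continuity of `v` on a compact
  sub-box).

## Mathlib / tree search

Tree: `IsRegularPoint`, `parabolicCylinderCentered`, `exists_parabolicCylinderCentered_subset`,
`mem_parabolicCylinderCentered_self`, `NSBoundedInteriorContinuity_holds`, `viscousCylinder(Opens)`,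
`stPreimage_viscousCylinderOpens_self`, `stAffine_preimage_viscousCylinder_self`,
`viscousCylinder_one_one_zero`, `IsDistributionalNSSolutionOn.stRescale`, `.mono_holds`,
`ae_restrict_preimage_stAffine`, `ae_restrict_of_ae_restrict_preimage_stAffine`,
`setLIntegral_enorm_rpow_stRescale`, `stAffineHomeomorph`. Mathlib:
`IsCompact.elim_finite_subcover`, `ae_restrict_biUnion_finset_iff`, `ae_le_eLpNormEssSup`,
`Measure.eqOn_open_of_ae_eq`, `IsOpen.ae_eq_zero_of_integral_contDiff_smul_eq_zero`,
`continuousOn_of_dominated`, `integral_inner`, `ext_inner_right`,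
`IsCompact.uniformContinuousOn_of_continuous`, `Measure.ae_ae_of_ae_prod`.

## References

* L. Caffarelli, R. Kohn, L. Nirenberg, Comm. Pure Appl. Math. 35 (1982), §6 (regular points).
  [CaffarelliKohnNirenberg1982]
* G. Seregin, V. Šverák, Comm. PDE 34 (2009) = arXiv:0804.1803, §2 p. 8 (continuity inside the
  region of essential boundedness). [SereginSverak2009]
* J. C. Robinson, J. L. Rodrigo, W. Sadowski, *The Three-Dimensional Navier–Stokes Equations*
  (CUP 2016), Thm. 13.5, §13.5. [RobinsonRodrigoSadowski2016]
* T. Barker, C. Prange, Arch. Ration. Mech. Anal. 236 (2020) = arXiv:1812.09115, §4.2.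
  [BarkerPrange2020]
-/

noncomputable section

open MeasureTheory TopologicalSpace Set Function Filter Metric
open _root_.Topology
open scoped ENNReal NNReal RealInnerProductSpace

namespace Literature.Analysis.FluidPDE

/-! ### Local essential boundedness from regular points -/

/-- **A compact set of regular points has a neighbourhood of essential boundedness**
(Caffarelli–Kohn–Nirenberg 1982, §6: the regular set is open and `u ∈ L^∞_loc` on it): if
every point of the compact `K ⊆ ℝ × ℝ³` is a regular point of `u` (`IsRegularPoint`: `u`
essentially bounded on some centred cylinder about it), then `K` has an open neighbourhood `U`
with `‖u‖ ≤ M` a.e. on `U` (finite subcover; the bound is the largest of the finitely many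
essential suprema). [cite: CaffarelliKohnNirenberg1982, §6 (regular points)] -/
theorem exists_isOpen_ae_bound_of_forall_isRegularPoint
    {u : ℝ → EuclideanSpace ℝ (Fin 3) → EuclideanSpace ℝ (Fin 3)}
    {K : Set (ℝ × EuclideanSpace ℝ (Fin 3))} (hK : IsCompact K)
    (hreg : ∀ z ∈ K, IsRegularPoint u z) :
    ∃ U : Set (ℝ × EuclideanSpace ℝ (Fin 3)), IsOpen U ∧ K ⊆ U ∧
      ∃ M : ℝ, ∀ᵐ z ∂(volume.restrict U), ‖uncurry u z‖ ≤ M := by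
  classical
  have h' : ∀ z : K, ∃ r : ℝ, 0 < r ∧ eLpNorm (uncurry u) ∞
      (volume.restrict (parabolicCylinderCentered r (z : ℝ × EuclideanSpace ℝ (Fin 3)))) < ∞ :=
    fun z => by
      obtain ⟨r, hr, h⟩ := hreg z z.2
      exact ⟨r, hr, h⟩
  choose r hr hfin using h'
  obtain ⟨t, ht⟩ := hK.elim_finite_subcover
    (fun z : K => parabolicCylinderCentered (r z) (z : ℝ × EuclideanSpace ℝ (Fin 3)))
    (fun z => isOpen_parabolicCylinderCentered _ _)
    (fun z hz => mem_iUnion.2 ⟨⟨z, hz⟩, mem_parabolicCylinderCentered_self (hr ⟨z, hz⟩) _⟩)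
  refine ⟨⋃ z ∈ t, parabolicCylinderCentered (r z) (z : ℝ × EuclideanSpace ℝ (Fin 3)),
    isOpen_biUnion fun z _ => isOpen_parabolicCylinderCentered _ _, ht, ?_⟩
  set Mx : ℝ≥0∞ := t.sup fun z => eLpNorm (uncurry u) ∞
    (volume.restrict (parabolicCylinderCentered (r z) (z : ℝ × EuclideanSpace ℝ (Fin 3)))) with hMx
  have hMtop : Mx < ∞ := (Finset.sup_lt_iff (by simp)).2 fun z _ => hfin z
  refine ⟨Mx.toReal, ?_⟩
  rw [ae_restrict_biUnion_finset_iff]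
  intro z hz
  have hle : eLpNorm (uncurry u) ∞
      (volume.restrict (parabolicCylinderCentered (r z) (z : ℝ × EuclideanSpace ℝ (Fin 3)))) ≤ Mx :=
    Finset.le_sup (f := fun z => eLpNorm (uncurry u) ∞
      (volume.restrict (parabolicCylinderCentered (r z) (z : ℝ × EuclideanSpace ℝ (Fin 3))))) hz
  rw [eLpNorm_exponent_top] at hle
  filter_upwards [ae_le_eLpNormEssSup (μ := volume.restrict
    (parabolicCylinderCentered (r z) (z : ℝ × EuclideanSpace ℝ (Fin 3)))) (f := uncurry u)] with w hw
  have h1 : ‖uncurry u w‖ₑ ≤ Mx := hw.trans hle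
  rw [← ofReal_norm] at h1
  exact (ENNReal.ofReal_le_iff_le_toReal hMtop.ne).1 h1

/-! ### Continuous representatives in viscous cylinders, at any viscosity -/

/-- **`NSBoundedInteriorContinuity` at viscosity `ν > 0`.** Let `(u, p)` solve the unforced
Navier–Stokes equations with viscosity `ν` in the sense of distributions in the viscous cylinder
`Q_ν(z, R) = (t₁ - R²/ν, t₁) × B(x, R)`, with `‖u‖ ≤ M` a.e. there and `p ∈ L^{3/2}(Q_ν(z, R))`.
Then `u` agrees a.e. on `Q_ν(z, R)` with a function continuous on `Q_ν(z, R)`: the rescaled pair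
`w(s, y) = (R/ν) u(t₁ + (R²/ν)s, x + Ry)`, `q = (R/ν)² p ∘ Φ` solves the equations with viscosity
`1` in the unit cylinder `Q(0, 1) = Φ⁻¹(Q_ν(z, R))`, is bounded and has `L^{3/2}` pressure
there (change of variables), so has a continuous representative `v'`
(`NSBoundedInteriorContinuity_holds`), and `v = (ν/R) v' ∘ Φ⁻¹` is the representative of `u`
(Seregin–Šverák 2009, §2 p. 8; Escauriaza–Seregin–Šverák 2003, §3, "making obvious scaling").
[cite: SereginSverak2009, §2 p. 8 (regularity inside the region of essential boundedness), with EscauriazaSereginSverak2003 §3 (scaling)] -/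
theorem exists_continuousOn_ae_eq_viscousCylinder {ν : ℝ} (hν : 0 < ν)
    {u : ℝ → EuclideanSpace ℝ (Fin 3) → EuclideanSpace ℝ (Fin 3)}
    {p : ℝ → EuclideanSpace ℝ (Fin 3) → ℝ} {R : ℝ} (hR : 0 < R) (t₁ : ℝ)
    (x : EuclideanSpace ℝ (Fin 3)) {M : ℝ}
    (hNS : IsDistributionalNSSolutionOn (viscousCylinderOpens ν R (t₁, x)) ν 0 u p)
    (hM : ∀ᵐ z ∂(volume.restrict (viscousCylinder ν R (t₁, x))), ‖u z.1 z.2‖ ≤ M)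
    (hp : ∫⁻ z in viscousCylinder ν R (t₁, x), ‖p z.1 z.2‖ₑ ^ (3 / 2 : ℝ) < ∞) :
    ∃ v : ℝ × EuclideanSpace ℝ (Fin 3) → EuclideanSpace ℝ (Fin 3),
      ContinuousOn v (viscousCylinder ν R (t₁, x)) ∧
      uncurry u =ᵐ[volume.restrict (viscousCylinder ν R (t₁, x))] v := by
  have hα : 0 < R / ν := by positivity
  have hβ : 0 < R ^ 2 / ν := by positivity
  have hβ' : R ^ 2 / ν = R / ν * R := by ring
  set V : Set (ℝ × EuclideanSpace ℝ (Fin 3)) := viscousCylinder ν R (t₁, x) with hV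
  set w : ℝ → EuclideanSpace ℝ (Fin 3) → EuclideanSpace ℝ (Fin 3) :=
    (R / ν) • stPull (R ^ 2 / ν) R t₁ x u with hw
  set q : ℝ → EuclideanSpace ℝ (Fin 3) → ℝ := (R / ν) ^ 2 • stPull (R ^ 2 / ν) R t₁ x p with hq
  have hpre : stAffine (R ^ 2 / ν) R t₁ x ⁻¹' V =
      parabolicCylinder 1 ((0 : ℝ), (0 : EuclideanSpace ℝ (Fin 3))) := by
    rw [hV, stAffine_preimage_viscousCylinder_self hν hR, viscousCylinder_one_one_zero]
  -- the rescaled pair solves the equations with viscosity `1` in the unit cylinder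
  have h1 : IsDistributionalNSSolutionOn
      (parabolicCylinderOpens 1 ((0 : ℝ), (0 : EuclideanSpace ℝ (Fin 3)))) 1 0 w q := by
    have h := hNS.stRescale hα hR hβ' t₁ x
    have e1 : R / ν * ν / R = 1 := by field_simp
    have e2 : ((R / ν) ^ 2 * R) • stPull (R ^ 2 / ν) R t₁ x
        (0 : ℝ → EuclideanSpace ℝ (Fin 3) → EuclideanSpace ℝ (Fin 3)) = 0 := by
      funext s y; simp [stPull]
    rw [e1, e2, stPreimage_viscousCylinderOpens_self hν hR, viscousCylinderOpens_one_one_zero] at h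
    exact h
  -- it is bounded there
  have hMw : ∀ᵐ z ∂(volume.restrict (parabolicCylinder 1 ((0 : ℝ), (0 : EuclideanSpace ℝ (Fin 3))))),
      ‖w z.1 z.2‖ ≤ R / ν * M := by
    rw [← hpre]
    filter_upwards [ae_restrict_preimage_stAffine hβ hR t₁ x hM] with z hz
    rw [hw, smul_stPull_apply, norm_smul, Real.norm_eq_abs, abs_of_pos hα]
    exact mul_le_mul_of_nonneg_left hz hα.le
  -- and its pressure is in `L^{3/2}`
  have hqint : ∫⁻ z in parabolicCylinder 1 ((0 : ℝ), (0 : EuclideanSpace ℝ (Fin 3))),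
      ‖q z.1 z.2‖ₑ ^ (3 / 2 : ℝ) < ∞ := by
    rw [← hpre, hq, setLIntegral_enorm_rpow_stRescale hβ hR t₁ x ((R / ν) ^ 2) p V (by norm_num)]
    exact ENNReal.mul_lt_top (ENNReal.mul_lt_top
      (ENNReal.rpow_lt_top_of_nonneg (by norm_num) enorm_ne_top) ENNReal.ofReal_lt_top) hp
  -- the continuous representative of the rescaled field, transported back
  obtain ⟨v', hv'c, hv'ae⟩ := NSBoundedInteriorContinuity_holds w q _ 1 (R / ν * M) h1 hMw hqint
  set e := stAffineHomeomorph hβ.ne' hR.ne' t₁ x with he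
  have hecoe : (e : ℝ × EuclideanSpace ℝ (Fin 3) → ℝ × EuclideanSpace ℝ (Fin 3)) =
      stAffine (R ^ 2 / ν) R t₁ x := rfl
  refine ⟨fun z => (ν / R) • v' (e.symm z), ?_, ?_⟩
  · -- continuity on `V = Φ(Q(0,1))`
    have hmaps : MapsTo e.symm V (parabolicCylinder 1 ((0 : ℝ), (0 : EuclideanSpace ℝ (Fin 3)))) := by
      intro z hz
      rw [← hpre, mem_preimage, ← hecoe, e.apply_symm_apply]
      exact hz
    exact (hv'c.comp e.symm.continuous.continuousOn hmaps).const_smul (ν / R)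
  · -- `u = (ν/R) v' ∘ Φ⁻¹` a.e. on `V`
    refine ae_restrict_of_ae_restrict_preimage_stAffine hβ hR t₁ x
      (P := fun z => uncurry u z = (ν / R) • v' (e.symm z)) ?_
    rw [hpre]
    filter_upwards [hv'ae] with z hz
    have hz' : (R / ν) • uncurry u (stAffine (R ^ 2 / ν) R t₁ x z) = v' z := hz
    have hsymm : e.symm (stAffine (R ^ 2 / ν) R t₁ x z) = z := by
      rw [← hecoe]; exact e.symm_apply_apply z
    change uncurry u (stAffine (R ^ 2 / ν) R t₁ x z) =
      (ν / R) • v' (e.symm (stAffine (R ^ 2 / ν) R t₁ x z))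
    rw [hsymm, ← hz', smul_smul]
    have e3 : ν / R * (R / ν) = 1 := by field_simp
    rw [e3, one_smul]

/-- **A continuous representative around a regular point.** Let `(u, p)` solve the unforced
Navier–Stokes equations (viscosity `ν > 0`) in the sense of distributions on an open set
`O ⊆ ℝ × ℝ³` with `p ∈ L^{3/2}_loc(O)` (on compact subsets), and let `(t₀, x) ∈ O` be a regular
point of `u` (`IsRegularPoint`: essentially bounded on a centred cylinder about it). Then there
are `δ, R > 0` such that the box `(t₀ - δ, t₀ + δ) × B(x, R)` lies in `O` and `u` has a
representative continuous on it (the box is a viscous cylinder `Q_ν((t₀ + δ, x), R)`,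
`δ = R²/(2ν)`, small enough to lie in the cylinder of essential boundedness and, with its
closure, in `O`; `exists_continuousOn_ae_eq_viscousCylinder`). (Caffarelli–Kohn–Nirenberg 1982,
§6; Seregin–Šverák 2009, §2 p. 8.) [cite: CaffarelliKohnNirenberg1982, §6 (regular points), with SereginSverak2009 §2 p. 8] -/
theorem exists_box_continuousOn_ae_eq_of_isRegularPoint {ν : ℝ} (hν : 0 < ν)
    {u : ℝ → EuclideanSpace ℝ (Fin 3) → EuclideanSpace ℝ (Fin 3)}
    {p : ℝ → EuclideanSpace ℝ (Fin 3) → ℝ} {O : Opens (ℝ × EuclideanSpace ℝ (Fin 3))}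
    (hNS : IsDistributionalNSSolutionOn O ν 0 u p)
    (hp : ∀ K ⊆ (O : Set (ℝ × EuclideanSpace ℝ (Fin 3))), IsCompact K →
      ∫⁻ z in K, ‖p z.1 z.2‖ₑ ^ (3 / 2 : ℝ) < ∞)
    {t₀ : ℝ} {x : EuclideanSpace ℝ (Fin 3)}
    (hz : ((t₀, x) : ℝ × EuclideanSpace ℝ (Fin 3)) ∈ (O : Set (ℝ × EuclideanSpace ℝ (Fin 3))))
    (hreg : IsRegularPoint u (t₀, x)) :
    ∃ δ : ℝ, 0 < δ ∧ ∃ R : ℝ, 0 < R ∧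
      Ioo (t₀ - δ) (t₀ + δ) ×ˢ ball x R ⊆ (O : Set (ℝ × EuclideanSpace ℝ (Fin 3))) ∧
      ∃ v : ℝ × EuclideanSpace ℝ (Fin 3) → EuclideanSpace ℝ (Fin 3),
        ContinuousOn v (Ioo (t₀ - δ) (t₀ + δ) ×ˢ ball x R) ∧
        uncurry u =ᵐ[volume.restrict (Ioo (t₀ - δ) (t₀ + δ) ×ˢ ball x R)] v := by
  -- the cylinder of essential boundedness and a centred cylinder inside `O`
  obtain ⟨ρ, hρ, hbd⟩ := hreg
  obtain ⟨ρ', hρ', -, hsub'⟩ := exists_parabolicCylinderCentered_subset O.isOpen hz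
  set ρ₀ : ℝ := min ρ ρ' with hρ₀
  have hρ₀pos : 0 < ρ₀ := lt_min hρ hρ'
  have hρ₀ρ : ρ₀ ≤ ρ := min_le_left _ _
  have hρ₀ρ' : ρ₀ ≤ ρ' := min_le_right _ _
  -- the radius `R` and the half-height `δ = R²/(2ν) ≤ ρ₀²/2`
  set R : ℝ := min (ρ₀ / 2) (Real.sqrt ν * ρ₀) with hRdef
  have hRpos : 0 < R := lt_min (by positivity) (mul_pos (Real.sqrt_pos.2 hν) hρ₀pos)
  have hRρ₀ : R ≤ ρ₀ / 2 := min_le_left _ _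
  have hR2 : R ^ 2 / (2 * ν) ≤ ρ₀ ^ 2 / 2 := by
    have h1 : R ≤ Real.sqrt ν * ρ₀ := min_le_right _ _
    have h2 : R ^ 2 ≤ (Real.sqrt ν * ρ₀) ^ 2 := pow_le_pow_left₀ hRpos.le h1 2
    rw [mul_pow, Real.sq_sqrt hν.le] at h2
    rw [div_le_div_iff₀ (by positivity) (by positivity)]
    nlinarith
  set δ : ℝ := R ^ 2 / (2 * ν) with hδdef
  have hδpos : 0 < δ := by positivity
  have hδρ₀ : δ < ρ₀ ^ 2 := by
    have : ρ₀ ^ 2 / 2 < ρ₀ ^ 2 := by nlinarith [sq_pos_of_pos hρ₀pos]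
    exact hR2.trans_lt this
  -- the box is the viscous cylinder `Q_ν((t₀ + δ, x), R)`
  have hVbox : viscousCylinder ν R (t₀ + δ, x) = Ioo (t₀ - δ) (t₀ + δ) ×ˢ ball x R := by
    rw [viscousCylinder]
    congr 1
    change Ioo (t₀ + δ - R ^ 2 / ν) (t₀ + δ) = Ioo (t₀ - δ) (t₀ + δ)
    congr 1
    rw [hδdef]
    field_simp
    ring
  -- the box inside the two centred cylinders
  have hboxsub : ∀ {r : ℝ}, ρ₀ ≤ r →
      Ioo (t₀ - δ) (t₀ + δ) ×ˢ ball x R ⊆ parabolicCylinderCentered r ((t₀ : ℝ), x) := by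
    intro r hr
    have hr2 : ρ₀ ^ 2 ≤ r ^ 2 := pow_le_pow_left₀ hρ₀pos.le hr 2
    rintro ⟨s, y⟩ ⟨⟨hs1, hs2⟩, hy⟩
    rw [mem_parabolicCylinderCentered]
    refine ⟨⟨by linarith, by linarith⟩, ?_⟩
    exact (mem_ball.1 hy).trans_le (by linarith)
  have hcl : Icc (t₀ - δ) (t₀ + δ) ×ˢ closedBall x R ⊆ (O : Set (ℝ × EuclideanSpace ℝ (Fin 3))) := by
    refine Subset.trans ?_ hsub'
    have hr2 : ρ₀ ^ 2 ≤ ρ' ^ 2 := pow_le_pow_left₀ hρ₀pos.le hρ₀ρ' 2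
    rintro ⟨s, y⟩ ⟨⟨hs1, hs2⟩, hy⟩
    rw [mem_parabolicCylinderCentered]
    refine ⟨⟨by linarith, by linarith⟩, ?_⟩
    exact (mem_closedBall.1 hy).trans_lt (by linarith)
  refine ⟨δ, hδpos, R, hRpos, (Set.prod_mono Subset.rfl ball_subset_closedBall).trans
    ((Set.prod_mono Ioo_subset_Icc_self Subset.rfl).trans hcl), ?_⟩
  -- hypotheses of the viscous-cylinder theorem
  have hle : viscousCylinderOpens ν R (t₀ + δ, x) ≤ O := by
    intro z hz'
    have hz'' : z ∈ Ioo (t₀ - δ) (t₀ + δ) ×ˢ ball x R := by rwa [← hVbox]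
    exact hcl ⟨⟨hz''.1.1.le, hz''.1.2.le⟩, ball_subset_closedBall hz''.2⟩
  have hNS' : IsDistributionalNSSolutionOn (viscousCylinderOpens ν R (t₀ + δ, x)) ν 0 u p :=
    IsDistributionalNSSolutionOn.mono_holds hNS hle
  have hM : ∃ M : ℝ, ∀ᵐ z ∂(volume.restrict (viscousCylinder ν R (t₀ + δ, x))), ‖u z.1 z.2‖ ≤ M := by
    set Mx : ℝ≥0∞ := eLpNorm (uncurry u) ∞ (volume.restrict (parabolicCylinderCentered ρ ((t₀ : ℝ), x)))
      with hMx
    refine ⟨Mx.toReal, ?_⟩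
    have h1 : ∀ᵐ z ∂(volume.restrict (parabolicCylinderCentered ρ ((t₀ : ℝ), x))), ‖uncurry u z‖ₑ ≤ Mx := by
      rw [hMx, eLpNorm_exponent_top]
      exact ae_le_eLpNormEssSup
    rw [hVbox]
    filter_upwards [ae_restrict_of_ae_restrict_of_subset (hboxsub hρ₀ρ) h1] with z hz'
    rw [← ofReal_norm] at hz'
    exact (ENNReal.ofReal_le_iff_le_toReal hbd.ne).1 hz'
  obtain ⟨M, hM⟩ := hM
  have hp' : ∫⁻ z in viscousCylinder ν R (t₀ + δ, x), ‖p z.1 z.2‖ₑ ^ (3 / 2 : ℝ) < ∞ := by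
    rw [hVbox]
    refine lt_of_le_of_lt (lintegral_mono_set ((Set.prod_mono Ioo_subset_Icc_self ball_subset_closedBall))) ?_
    exact hp _ hcl (isCompact_Icc.prod (isCompact_closedBall x R))
  obtain ⟨v, hvc, hvae⟩ := exists_continuousOn_ae_eq_viscousCylinder hν hRpos (t₀ + δ) x hNS' hM hp'
  rw [hVbox] at hvc hvae
  exact ⟨v, hvc, hvae⟩

/-! ### Every time slice of a weakly continuous field is the slice of its continuous representative -/

/-- **Continuity in time of the pairing of a continuous representative with a test field**
(dominated convergence on the ball, the integrand being bounded on `[a', b'] × supp g` and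
continuous in `t` for every `y`). [folklore] -/
theorem continuousOn_setIntegral_inner_smul_of_continuousOn
    {v : ℝ × EuclideanSpace ℝ (Fin 3) → EuclideanSpace ℝ (Fin 3)} {a b : ℝ}
    {x : EuclideanSpace ℝ (Fin 3)} {R : ℝ} (hv : ContinuousOn v (Ioo a b ×ˢ ball x R))
    {g : EuclideanSpace ℝ (Fin 3) → ℝ} (hg : Continuous g) (hgc : HasCompactSupport g)
    (hgs : tsupport g ⊆ ball x R) (e : EuclideanSpace ℝ (Fin 3)) {a' b' : ℝ}
    (hI' : Icc a' b' ⊆ Ioo a b) :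
    ContinuousOn (fun τ => ∫ y in ball x R, ⟪v (τ, y), g y • e⟫) (Icc a' b') := by
  haveI : IsFiniteMeasure (volume.restrict (ball x R)) :=
    ⟨by rw [Measure.restrict_apply_univ]; exact measure_ball_lt_top⟩
  obtain ⟨Cg, hCg⟩ := hgc.exists_bound_of_continuous hg
  have hSc : IsCompact (Icc a' b' ×ˢ tsupport g) := isCompact_Icc.prod hgc
  have hSsub : Icc a' b' ×ˢ tsupport g ⊆ Ioo a b ×ˢ ball x R := Set.prod_mono hI' hgs
  obtain ⟨Bv₀, hBv₀⟩ := hSc.exists_bound_of_continuousOn (hv.mono hSsub)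
  set Bv : ℝ := max Bv₀ 0 with hBvdef
  have hBv : ∀ z ∈ Icc a' b' ×ˢ tsupport g, ‖v z‖ ≤ Bv := fun z hz =>
    (hBv₀ z hz).trans (le_max_left _ _)
  have hBv0 : 0 ≤ Bv := le_max_right _ _
  refine continuousOn_of_dominated (μ := volume.restrict (ball x R))
    (F := fun τ y => ⟪v (τ, y), g y • e⟫) (bound := fun _ => Bv * (Cg * ‖e‖)) ?_ ?_
    (integrable_const _) ?_
  · intro τ hτ
    have hvτ : ContinuousOn (fun y => v (τ, y)) (ball x R) :=
      hv.comp (continuousOn_const.prodMk continuousOn_id) fun y hy => ⟨hI' hτ, hy⟩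
    exact (hvτ.inner ((hg.smul continuous_const).continuousOn)).aestronglyMeasurable
      measurableSet_ball
  · intro τ hτ
    refine (ae_restrict_mem measurableSet_ball).mono fun y _ => ?_
    by_cases hyS : y ∈ tsupport g
    · calc ‖⟪v (τ, y), g y • e⟫‖ ≤ ‖v (τ, y)‖ * ‖g y • e‖ := norm_inner_le_norm _ _
        _ ≤ Bv * (Cg * ‖e‖) := by
            rw [norm_smul]
            exact mul_le_mul (hBv _ ⟨hτ, hyS⟩)
              (mul_le_mul_of_nonneg_right (hCg y) (norm_nonneg _)) (by positivity) hBv0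
    · rw [image_eq_zero_of_notMem_tsupport hyS, zero_smul, inner_zero_right, norm_zero]
      have : 0 ≤ Cg := (norm_nonneg _).trans (hCg y)
      positivity
  · refine (ae_restrict_mem measurableSet_ball).mono fun y hy => ?_
    have hvy : ContinuousOn (fun τ => v (τ, y)) (Icc a' b') :=
      hv.comp (continuousOn_id.prodMk continuousOn_const) fun τ hτ => ⟨hI' hτ, hy⟩
    exact hvy.inner continuousOn_const

/-- **Integrability of a continuous representative against a test function, on one slice**
(the product vanishes off the compact `supp g ⊆ B(x, R)` and is bounded on it). [folklore] -/
theorem integrable_smul_slice_of_continuousOn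
    {v : ℝ × EuclideanSpace ℝ (Fin 3) → EuclideanSpace ℝ (Fin 3)} {a b : ℝ}
    {x : EuclideanSpace ℝ (Fin 3)} {R : ℝ} (hv : ContinuousOn v (Ioo a b ×ˢ ball x R))
    {g : EuclideanSpace ℝ (Fin 3) → ℝ} (hg : Continuous g) (hgc : HasCompactSupport g)
    (hgs : tsupport g ⊆ ball x R) {t : ℝ} (ht : t ∈ Ioo a b) :
    Integrable (fun y => g y • v (t, y)) volume := by
  obtain ⟨Cg, hCg⟩ := hgc.exists_bound_of_continuous hg
  have hSc : IsCompact (({t} : Set ℝ) ×ˢ tsupport g) := isCompact_singleton.prod hgc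
  have hSsub : ({t} : Set ℝ) ×ˢ tsupport g ⊆ Ioo a b ×ˢ ball x R :=
    Set.prod_mono (singleton_subset_iff.2 ht) hgs
  obtain ⟨Bv, hBv⟩ := hSc.exists_bound_of_continuousOn (hv.mono hSsub)
  have hsupp : support (fun y => g y • v (t, y)) ⊆ tsupport g := by
    intro y hy
    by_contra h
    exact hy (show g y • v (t, y) = 0 by rw [image_eq_zero_of_notMem_tsupport h, zero_smul])
  rw [← integrableOn_iff_integrable_of_support_subset hsupp]
  haveI : IsFiniteMeasure (volume.restrict (tsupport g)) :=
    ⟨by rw [Measure.restrict_apply_univ]; exact hgc.measure_lt_top⟩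
  refine ⟨?_, HasFiniteIntegral.of_bounded (C := Cg * Bv) ?_⟩
  · exact (hg.continuousOn.smul (hv.comp (continuousOn_const.prodMk continuousOn_id)
      fun y hy => ⟨ht, hgs hy⟩)).aestronglyMeasurable (isClosed_tsupport g).measurableSet
  · refine (ae_restrict_mem (isClosed_tsupport g).measurableSet).mono fun y hy => ?_
    rw [norm_smul]
    exact mul_le_mul (hCg y) (hBv _ ⟨rfl, hy⟩) (norm_nonneg _) ((norm_nonneg _).trans (hCg y))

/-- **Identification of every slice.** Let `u : ℝ → ℝ³ → ℝ³` be weakly continuous in time on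
the open interval `(a, b)` — `t ↦ ∫ ⟪u(t), w⟫` is continuous on `(a, b)` for every `w ∈ L²` (as
for Leray–Hopf weak solutions) — with locally integrable slices, and suppose `u = v` a.e. on the
box `(a, b) × B(x, R)` for a function `v` continuous on the box. Then for **every**
`t ∈ (a, b)`, `u(t) = v(t, ·)` a.e. on `B(x, R)`: for `g ∈ C_c^∞(B(x, R))` and a direction `e`,
both `t ↦ ∫ ⟪u(t), g e⟫` and `t ↦ ∫ ⟪v(t, ·), g e⟫` are continuous near `t` (the second by
dominated convergence) and agree for a.e. `t` (Fubini), hence at `t`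
(`Measure.eqOn_open_of_ae_eq`); so `∫ g (u(t) - v(t, ·)) = 0` for all such `g`, and the
fundamental lemma of the calculus of variations concludes (Robinson–Rodrigo–Sadowski 2016,
§13.5: passage from a.e. time to every time through weak continuity). [folklore] -/
theorem ae_eq_slice_of_weaklyContinuous_of_continuousOn
    {u : ℝ → EuclideanSpace ℝ (Fin 3) → EuclideanSpace ℝ (Fin 3)}
    {v : ℝ × EuclideanSpace ℝ (Fin 3) → EuclideanSpace ℝ (Fin 3)} {a b : ℝ}
    {x : EuclideanSpace ℝ (Fin 3)} {R : ℝ}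
    (hwc : ∀ w : EuclideanSpace ℝ (Fin 3) → EuclideanSpace ℝ (Fin 3), MemLp w 2 volume →
      ContinuousOn (fun t => ∫ y, ⟪u t y, w y⟫) (Ioo a b))
    (hloc : ∀ t ∈ Ioo a b, LocallyIntegrable (u t) volume)
    (hv : ContinuousOn v (Ioo a b ×ˢ ball x R))
    (hae : uncurry u =ᵐ[volume.restrict (Ioo a b ×ˢ ball x R)] v)
    {t : ℝ} (ht : t ∈ Ioo a b) :
    ∀ᵐ y ∂(volume.restrict (ball x R)), u t y = v (t, y) := by
  -- a compact time window around `t`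
  obtain ⟨a', ha', hta'⟩ : ∃ a', a < a' ∧ a' < t := exists_between ht.1
  obtain ⟨b', htb', hb'⟩ : ∃ b', t < b' ∧ b' < b := exists_between ht.2
  have hI' : Icc a' b' ⊆ Ioo a b := fun s hs => ⟨ha'.trans_le hs.1, hs.2.trans_lt hb'⟩
  -- slices of `u` agree with slices of `v` for a.e. time (Fubini)
  have hae' : ∀ᵐ τ ∂(volume.restrict (Ioo a b)), ∀ᵐ y ∂(volume.restrict (ball x R)),
      u τ y = v (τ, y) := by
    have h1 : uncurry u =ᵐ[(volume.restrict (Ioo a b)).prod (volume.restrict (ball x R))] v := by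
      rw [Measure.prod_restrict, ← Measure.volume_eq_prod]; exact hae
    exact Measure.ae_ae_of_ae_prod h1
  -- the fundamental lemma on the ball, for the slice at `t`
  have hlocv : LocallyIntegrableOn (fun y => v (t, y)) (ball x R) volume :=
    (hv.comp (continuousOn_const.prodMk continuousOn_id) fun y hy => ⟨ht, hy⟩).locallyIntegrableOn
      measurableSet_ball
  have hloct : LocallyIntegrableOn (fun y => u t y - v (t, y)) (ball x R) volume :=
    ((hloc t ht).locallyIntegrableOn _).sub hlocv
  have key := isOpen_ball.ae_eq_zero_of_integral_contDiff_smul_eq_zero hloct ?_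
  · rw [ae_restrict_iff' measurableSet_ball]
    filter_upwards [key] with y hy hyB
    exact sub_eq_zero.1 (hy hyB)
  intro g hg hgc hgs
  have hgcont : Continuous g := hg.continuous
  have hg0 : ∀ y ∉ ball x R, g y = 0 := fun y hy =>
    image_eq_zero_of_notMem_tsupport fun h => hy (hgs h)
  -- the two pairings agree at `t`, for every direction `e`
  have hpair : ∀ e : EuclideanSpace ℝ (Fin 3),
      ∫ y, ⟪u t y, g y • e⟫ = ∫ y in ball x R, ⟪v (t, y), g y • e⟫ := by
    intro e
    have hwL2 : MemLp (fun y => g y • e) 2 volume :=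
      (hgcont.smul continuous_const).memLp_of_hasCompactSupport hgc.smul_right
    have hF : ContinuousOn (fun τ => ∫ y, ⟪u τ y, g y • e⟫) (Ioo a' b') :=
      (hwc _ hwL2).mono (Ioo_subset_Icc_self.trans hI')
    have hG : ContinuousOn (fun τ => ∫ y in ball x R, ⟪v (τ, y), g y • e⟫) (Ioo a' b') :=
      (continuousOn_setIntegral_inner_smul_of_continuousOn hv hgcont hgc hgs e hI').mono
        Ioo_subset_Icc_self
    have hFG : (fun τ => ∫ y, ⟪u τ y, g y • e⟫) =ᵐ[volume.restrict (Ioo a' b')]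
        fun τ => ∫ y in ball x R, ⟪v (τ, y), g y • e⟫ := by
      refine ae_restrict_of_ae_restrict_of_subset (Ioo_subset_Icc_self.trans hI') ?_
      filter_upwards [hae'] with τ hτ
      have h0 : ∀ y ∉ ball x R, ⟪u τ y, g y • e⟫ = 0 := fun y hy => by
        rw [hg0 y hy, zero_smul, inner_zero_right]
      rw [← setIntegral_eq_integral_of_forall_compl_eq_zero h0]
      refine integral_congr_ae ?_
      filter_upwards [hτ] with y hy
      rw [hy]
    exact Measure.eqOn_open_of_ae_eq hFG isOpen_Ioo hF hG ⟨hta', htb'⟩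
  -- conclusion: `∫ g • (u t - v(t, ·)) = 0`
  have hIu : Integrable (fun y => g y • u t y) volume :=
    (hloc t ht).integrable_smul_left_of_hasCompactSupport hgcont hgc
  have hIv : Integrable (fun y => g y • v (t, y)) volume :=
    integrable_smul_slice_of_continuousOn hv hgcont hgc hgs ht
  have hsub : (fun y => g y • (u t y - v (t, y))) = fun y => g y • u t y - g y • v (t, y) := by
    funext y; rw [smul_sub]
  rw [hsub, integral_sub hIu hIv, sub_eq_zero]
  refine ext_inner_left ℝ fun e => ?_
  rw [← integral_inner hIu e, ← integral_inner hIv e]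
  have e1 : ∀ y, ⟪e, g y • u t y⟫ = ⟪u t y, g y • e⟫ := fun y => by
    rw [real_inner_smul_right, real_inner_smul_right, real_inner_comm]
  have e2 : ∀ y, ⟪e, g y • v (t, y)⟫ = ⟪v (t, y), g y • e⟫ := fun y => by
    rw [real_inner_smul_right, real_inner_smul_right, real_inner_comm]
  simp_rw [e1, e2]
  rw [hpair e]
  have h0 : ∀ y ∉ ball x R, ⟪v (t, y), g y • e⟫ = 0 := fun y hy => by
    rw [hg0 y hy, zero_smul, inner_zero_right]
  exact setIntegral_eq_integral_of_forall_compl_eq_zero h0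

/-! ### Local `L²`-continuity in time at a time of continuity -/

/-- **Strong `L²_loc`-continuity in time from a continuous representative.** If `v` is
continuous on the box `(a, b) × B(x, R)` and, for every `τ ∈ (a, b)`, `u(τ) = v(τ, ·)` a.e. on
`B(x, R)` (`ae_eq_slice_of_weaklyContinuous_of_continuousOn`), then for `t ∈ (a, b)` and
`ρ < R`, `∫_{B̄(x, ρ)} |u(t + s) - u(t)|² → 0` as `s → 0` (uniform continuity of `v` on a
compact sub-box `[t - δ, t + δ] × B̄(x, ρ)`). This is the attainment of the datum in `L²_loc`
((B.1.7) of Seregin 2014, Def. B.1) at a time of continuity. [folklore] -/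
theorem tendsto_lintegral_closedBall_sub_sq_of_continuousOn
    {u : ℝ → EuclideanSpace ℝ (Fin 3) → EuclideanSpace ℝ (Fin 3)}
    {v : ℝ × EuclideanSpace ℝ (Fin 3) → EuclideanSpace ℝ (Fin 3)} {a b : ℝ}
    {x : EuclideanSpace ℝ (Fin 3)} {R : ℝ}
    (hv : ContinuousOn v (Ioo a b ×ˢ ball x R))
    (hid : ∀ τ ∈ Ioo a b, ∀ᵐ y ∂(volume.restrict (ball x R)), u τ y = v (τ, y))
    {t : ℝ} (ht : t ∈ Ioo a b) {ρ : ℝ} (hρR : ρ < R) :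
    Tendsto (fun s => ∫⁻ y in closedBall x ρ, ‖u (t + s) y - u t y‖ₑ ^ 2) (𝓝 0) (𝓝 0) := by
  -- a compact sub-box around `{t} × B̄(x, ρ)`
  obtain ⟨δ, hδ, hδsub⟩ : ∃ δ : ℝ, 0 < δ ∧ Icc (t - δ) (t + δ) ⊆ Ioo a b := by
    refine ⟨min (t - a) (b - t) / 2, by
      have := ht.1; have := ht.2; positivity, fun s hs => ?_⟩
    have h1 : min (t - a) (b - t) ≤ t - a := min_le_left _ _
    have h2 : min (t - a) (b - t) ≤ b - t := min_le_right _ _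
    exact ⟨by linarith [hs.1, ht.1, ht.2], by linarith [hs.2, ht.1, ht.2]⟩
  set K : Set (ℝ × EuclideanSpace ℝ (Fin 3)) := Icc (t - δ) (t + δ) ×ˢ closedBall x ρ with hK
  have hKc : IsCompact K := isCompact_Icc.prod (isCompact_closedBall x ρ)
  have hKsub : K ⊆ Ioo a b ×ˢ ball x R := Set.prod_mono hδsub (closedBall_subset_ball hρR)
  have huc : UniformContinuousOn v K := hKc.uniformContinuousOn_of_continuous (hv.mono hKsub)
  have hVfin : volume (closedBall x ρ) ≠ ∞ := measure_closedBall_lt_top.ne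
  -- slices of `u` are slices of `v` on the closed ball, at every time of the window
  have hid' : ∀ τ ∈ Ioo a b, ∀ᵐ y ∂(volume.restrict (closedBall x ρ)), u τ y = v (τ, y) :=
    fun τ hτ => ae_restrict_of_ae_restrict_of_subset (closedBall_subset_ball hρR) (hid τ hτ)
  refine ENNReal.tendsto_nhds_zero.2 fun ε hε => ?_
  -- a real `ε' > 0` with `ε'² |B̄| ≤ ε`
  obtain ⟨ε', hε'pos, hε'⟩ : ∃ ε' : ℝ, 0 < ε' ∧ ENNReal.ofReal (ε' ^ 2) * volume (closedBall x ρ) ≤ ε := by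
    have hlim : Tendsto (fun ε' : ℝ => ENNReal.ofReal (ε' ^ 2) * volume (closedBall x ρ))
        (𝓝 0) (𝓝 0) := by
      have h1 : Tendsto (fun ε' : ℝ => ENNReal.ofReal (ε' ^ 2)) (𝓝 0) (𝓝 0) := by
        have h2 : Tendsto (fun ε' : ℝ => ε' ^ 2) (𝓝 0) (𝓝 0) := by
          have := (continuous_pow 2).tendsto (0 : ℝ)
          rwa [zero_pow two_ne_zero] at this
        have h3 := ENNReal.tendsto_ofReal h2
        rwa [ENNReal.ofReal_zero] at h3
      have h4 := ENNReal.Tendsto.mul_const h1 (Or.inr hVfin)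
      rwa [zero_mul] at h4
    have hev : ∀ᶠ ε' in 𝓝[>] (0 : ℝ), ENNReal.ofReal (ε' ^ 2) * volume (closedBall x ρ) ≤ ε :=
      (hlim.mono_left nhdsWithin_le_nhds).eventually (Iic_mem_nhds hε)
    obtain ⟨ε', h1, h2⟩ := (hev.and self_mem_nhdsWithin).exists
    exact ⟨ε', h2, h1⟩
  -- uniform continuity on `K`
  obtain ⟨η, hη, hηuc⟩ := Metric.uniformContinuousOn_iff_le.1 huc ε' hε'pos
  -- for `|s| < min η δ` the bound holds
  have hev : ∀ᶠ s in 𝓝 (0 : ℝ), |s| < min η δ := by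
    have : Metric.ball (0 : ℝ) (min η δ) ∈ 𝓝 (0 : ℝ) := Metric.ball_mem_nhds _ (lt_min hη hδ)
    filter_upwards [this] with s hs
    rwa [Metric.mem_ball, dist_zero_right, Real.norm_eq_abs] at hs
  filter_upwards [hev] with s hs
  have hsη : |s| < η := hs.trans_le (min_le_left _ _)
  have hsδ : |s| < δ := hs.trans_le (min_le_right _ _)
  have hts : t + s ∈ Ioo a b := hδsub ⟨by linarith [(abs_lt.1 hsδ).1], by linarith [(abs_lt.1 hsδ).2]⟩
  -- replace `u` by `v` on the closed ball
  have hcongr : ∫⁻ y in closedBall x ρ, ‖u (t + s) y - u t y‖ₑ ^ 2 =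
      ∫⁻ y in closedBall x ρ, ‖v (t + s, y) - v (t, y)‖ₑ ^ 2 := by
    refine lintegral_congr_ae ?_
    filter_upwards [hid' (t + s) hts, hid' t ht] with y h1 h2
    rw [h1, h2]
  rw [hcongr]
  -- pointwise bound from uniform continuity
  have hpt : ∀ y ∈ closedBall x ρ, ‖v (t + s, y) - v (t, y)‖ₑ ^ 2 ≤ ENNReal.ofReal (ε' ^ 2) := by
    intro y hy
    have hm1 : ((t + s, y) : ℝ × EuclideanSpace ℝ (Fin 3)) ∈ K :=
      ⟨⟨by linarith [(abs_lt.1 hsδ).1], by linarith [(abs_lt.1 hsδ).2]⟩, hy⟩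
    have hm2 : ((t, y) : ℝ × EuclideanSpace ℝ (Fin 3)) ∈ K := ⟨⟨by linarith, by linarith⟩, hy⟩
    have hdist : dist ((t + s, y) : ℝ × EuclideanSpace ℝ (Fin 3)) (t, y) ≤ η := by
      rw [Prod.dist_eq, dist_self, Real.dist_eq, add_sub_cancel_left]
      exact max_le hsη.le hη.le
    have h1 : dist (v (t + s, y)) (v (t, y)) ≤ ε' := hηuc _ hm1 _ hm2 hdist
    rw [dist_eq_norm] at h1
    rw [← ofReal_norm, ← ENNReal.ofReal_pow (norm_nonneg _)]
    exact ENNReal.ofReal_le_ofReal (pow_le_pow_left₀ (norm_nonneg _) h1 2)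
  calc ∫⁻ y in closedBall x ρ, ‖v (t + s, y) - v (t, y)‖ₑ ^ 2
      ≤ ∫⁻ _ in closedBall x ρ, ENNReal.ofReal (ε' ^ 2) :=
        setLIntegral_mono measurable_const hpt
    _ = ENNReal.ofReal (ε' ^ 2) * volume (closedBall x ρ) := setLIntegral_const _ _
    _ ≤ ε := hε'

end Literature.Analysis.FluidPDE

end
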